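import Summits.AtomisticToContinuum.Crystallization.Theorems.FreeSplittingCertificatesRadiusLadderDelsarte7
import Summits.AtomisticToContinuum.Crystallization.Theorems.FreeSplittingCertificatesRadiusLadderShellCount
import Summits.AtomisticToContinuum.Crystallization.Theorems.FreeSplittingCertificatesRadiusLadderHalfRule65Table
import Summits.AtomisticToContinuum.Crystallization.Theorems.FreeSplittingCertificatesRadiusLadderStar902

/-!
# `FiniteRangeSplitting` (stmt-AtomisticToContinuum-12559): the half rule is feasible from hard core `6/5` on

Support file for crux r2 of route `FreeSplittingCertificates` (block-2b unit `b2b-freesplit-A`, gen 13, second rung).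
VALUE = a theorem deciding instances of the crux (the bracket of the sharp threshold `δ_½` shrinks from
`[47/50, 5/4]` to `[47/50, 6/5]`) — NOT summit progress.

`…RadiusLadderHalfRule54` certified `RungAt δ R` for all `δ ≥ 5/4` by a layer cake on `t_k = 5/4 + k/20` whose thin
shells were counted by Delsarte's bound at degree `5`.  At hard core `6/5` degree `5` no longer suffices (its angular
bounds blow up beyond cosine `≈ 0.77`, i.e. from the shell `t = 1.75` on, and the layer cake misses `−1.435`); here
    the
same layer cake is run at `δ = 6/5` on the grid `t_k = 6/5 + k/20` (`k ≤ 72`, `t_72 = 24/5 = 4δ`) with the counts of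
the THIN shells `t_{k+1} ≤ 1.90` (`k ≤ 13`; `t(t − δ) ≤ δ²` holds up to `t ≈ 1.94`) taken from DELSARTE'S BOUND AT
DEGREE `7` (`…RadiusLadderDelsarte7`, `…RadiusLadderShellCount`: unit vectors with pairwise cosine `≤ 1 − δ²/(2t²)`
number at most `14, 15, 17, 18, 20, 21, 23, 24, 26, 28, 31, 34, 38, 43`), and from volume packing beyond.  With the
tabulated values `v_k = ⌊10⁶ V(t_k)⌋/10⁶` and the tree's far tail `Σ_{r ≥ 4δ} r⁻⁶ ≤ (1331/512) δ⁻⁶`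
(`sum_inv_pow_six_far_le`) the resulting rational inequality `Σ_k (v_k − v_{k+1}) m_k − (1331/512)(6/5)⁻⁶/6 ≥ −1.435`
holds with margin `0.030` (`gridQ65_ge`, `decide +kernel`; value `≈ −1.40492`), so at every site of every
`6/5`-separated configuration the half pair-sum is `≥ −0.7175 ≥ e_∞` (`halfSum_ge_of_sep65`, `eInf_le_ref`):

* `halfSumFeasible_six_fifths`, `feasible_halfRule_six_fifths`, `rungAt_six_fifths`,
  `rungAt_of_six_fifths_le`, `exists_rung_of_six_fifths_le` — the crux's `δ`-instances are THEOREMS for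
  `δ ≥ 6/5` (witness: the half rule, any radius);
* `halfSumThreshold_le_six_fifths`, `halfSumThreshold_mem_Icc_47_50_6_5` — the sharp threshold of
  `…RadiusLadderThreshold` now satisfies `47/50 ≤ δ_½ ≤ 6/5`;
* `rungAt_lt_sep_decided65` — for `0 < R < δ`: `RungAt δ R` holds if `δ ≥ 6/5`, fails if `δ ≤ 47/50`.

Reach of the method (recorded, not formalised): the LP forecast with Delsarte degree `9`/`11`, grid `1/40` and
annulus chaining bottoms out near hard core `1.17–1.18`; `1.15` is out of reach of angular LP bounds of any degree
`≤ 11` with this far tail.  The true `δ_½` is presumably close to `1`.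
-/

noncomputable section

namespace Summit.AtomisticToContinuum.Crystallization.Theorems.StrictSplittingRuleBirth

open scoped BigOperators Classical
open Literature.MathematicalPhysics.StatisticalMechanics

/-! ## The grid over `ℝ`: casts and elementary facts -/

/-- The rational and real grids agree. -/
theorem tk65_cast (k : ℕ) : ((tq65 k : ℚ) : ℝ) = tk65 k := by
  simp only [tq65, tk65]
  push_cast
  ring

/-- The rational and real envelope counts agree. -/
theorem mk65_cast (k : ℕ) : ((mq65 k : ℚ) : ℝ) = mk65 k := by
  simp only [mq65, mk65]
  split_ifs
  · push_cast
    rfl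
  · simp only [← tk65_cast]
    push_cast
    ring

/-- The grid is monotone. -/
theorem tk65_mono : Monotone tk65 := fun a b hab => by
  simp only [tk65]
  have : (a : ℝ) ≤ b := by exact_mod_cast hab
  linarith

/-- The grid starts at `6/5`. -/
theorem six_fifths_le_tk65 (k : ℕ) : 6 / 5 ≤ tk65 k := by
  simp only [tk65]
  have : (0 : ℝ) ≤ (k : ℝ) / 20 := by positivity
  linarith

/-- The last grid point `t_72 = 24/5 = 4·(6/5)`. -/
theorem tk65_last : tk65 72 = 4 * (6 / 5) := by norm_num [tk65]

/-- Beyond the table the value is `0`. -/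
theorem vk65_last : vk65 72 = 0 := by
  have : vq65 72 = 0 := rfl
  simp [vk65, this]

/-- The rational and real potentials agree on the grid. -/
theorem ljQ_cast65 (k : ℕ) : ((ljQ (tq65 k) : ℚ) : ℝ) = lennardJones (tk65 k) := by
  simp only [ljQ, lennardJones, ← tk65_cast]
  push_cast
  ring

/-- The table under-estimates `V` on the grid (cast from `vq65_le_ljQ`). -/
theorem vk65_le_lennardJones (k : ℕ) (hk : k < 72) : vk65 k ≤ lennardJones (tk65 k) := by
  have h := (Rat.cast_le (K := ℝ)).2 (vq65_le_ljQ k hk)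
  rwa [ljQ_cast65] at h

/-- The layer weights are nonpositive (the table is nondecreasing). -/
theorem wk65_nonpos {k : ℕ} (hk : k < 72) : wk65 k ≤ 0 := by
  have h := (Rat.cast_le (K := ℝ)).2 (vq65_le_succ k hk)
  simp only [wk65, vk65]
  linarith

/-- The grid constant over `ℝ`: `Σ_k w_k m_k − (1331/512)(6/5)⁻⁶/6 ≥ −1.435`. -/
theorem grid65_sum_ge :
    -(1435 / 1000 : ℝ) ≤
      ∑ k ∈ Finset.range 72, wk65 k * mk65 k - (1 / 6) * (1331 / 512 * (6 / 5 : ℝ)⁻¹ ^ 6) := by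
  have h := (Rat.cast_le (K := ℝ)).2 gridQ65_ge
  have e : ((gridQ65 : ℚ) : ℝ) =
      ∑ k ∈ Finset.range 72, wk65 k * mk65 k - (1 / 6) * (1331 / 512 * (6 / 5 : ℝ)⁻¹ ^ 6) := by
    simp only [gridQ65, wk65, vk65, ← mk65_cast]
    push_cast
    rfl
  have e' : ((-(1435 / 1000 : ℚ) : ℚ) : ℝ) = -(1435 / 1000 : ℝ) := by push_cast; rfl
  linarith [h, e, e']

/-! ## The layer-cake majorant at hard core `6/5` -/

/-- **Pointwise majorant**: for `r ≥ 6/5`, `V(r) ≥ layer65 r + tailTerm65 r`. -/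
theorem layer65_add_tail_le {r : ℝ} (hr : 6 / 5 ≤ r) : layer65 r + tailTerm65 r ≤ lennardJones r := by
  by_cases hfar : tk65 72 ≤ r
  · -- far: every indicator vanishes, the tail term is the attractive part
    have h0 : layer65 r = 0 := by
      refine Finset.sum_eq_zero fun k hk => ?_
      have hk : k + 1 ≤ 72 := Finset.mem_range.1 hk
      have : ¬ r < tk65 (k + 1) := not_lt.2 ((tk65_mono hk).trans hfar)
      simp [this]
    rw [h0, zero_add, tailTerm65, if_pos hfar]
    have hr0 : 0 < r := by linarith
    exact neg_le_lennardJones_of_le hr0 le_rfl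
  · -- near: `t_{k₀} ≤ r < t_{k₀+1}` with `k₀ < 72`
    rw [not_le] at hfar
    have hr0 : 0 ≤ (r - 6 / 5) * 20 := by linarith
    set k₀ : ℕ := ⌊(r - 6 / 5) * 20⌋₊ with hk₀
    have h1 : tk65 k₀ ≤ r := by
      have := Nat.floor_le hr0
      simp only [tk65]; linarith
    have h2 : r < tk65 (k₀ + 1) := by
      have := Nat.lt_floor_add_one ((r - 6 / 5) * 20)
      simp only [tk65]; push_cast; linarith
    have hkK : k₀ < 72 := by
      by_contra h
      rw [not_lt] at h
      have : tk65 72 ≤ tk65 k₀ := tk65_mono h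
      linarith
    have hind : ∀ k, (r < tk65 (k + 1) ↔ k₀ ≤ k) := fun k => by
      constructor
      · intro h
        by_contra hlt
        rw [not_le] at hlt
        have : tk65 (k + 1) ≤ tk65 k₀ := tk65_mono (by omega)
        linarith
      · intro h
        have : tk65 (k₀ + 1) ≤ tk65 (k + 1) := tk65_mono (by omega)
        linarith
    have hsum : layer65 r = vk65 k₀ - vk65 72 := by
      rw [← sum_ite_sub_eq vk65 k₀ 72 hkK.le]
      refine Finset.sum_congr rfl fun k _ => ?_
      by_cases h : k₀ ≤ k
      · rw [if_pos ((hind k).2 h), if_pos h, wk65, mul_one]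
      · have : ¬ r < tk65 (k + 1) := fun h' => h ((hind k).1 h')
        rw [if_neg this, if_neg h, mul_zero]
    rw [hsum, vk65_last, sub_zero, tailTerm65, if_neg (not_le.2 hfar), add_zero]
    exact (vk65_le_lennardJones k₀ hkK).trans
      (Literature.Barriers.AtomisticToContinuum.strictMonoOn_lennardJones.monotoneOn
        (Set.mem_Ici.2 (le_trans (by norm_num) (six_fifths_le_tk65 k₀)))
        (Set.mem_Ici.2 (le_trans (by norm_num) hr)) h1)

/-! ## Shell counts under the envelope -/

/-- Shell `k = 0`: at most `14` neighbours at distance `< t_1 = 1.25` (degree-`7` angular count). -/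
theorem angCount65_0 {N : ℕ} {x : Fin N → EuclideanSpace ℝ (Fin 3)} (hx : Sep (6 / 5) x) (i : Fin N) :
    ((((Finset.univ.erase i).filter fun j => dist (x i) (x j) < tk65 (0 + 1)).card : ℕ) : ℝ) ≤ ((angD65 0 : ℕ) : ℝ) :=
  card_near_le_of_angular' (δ := 6 / 5) (t := tk65 (0 + 1)) (by norm_num) (by norm_num [tk65]) (angD65 0)
    (fun s u hu h => (card_le65_14 s u hu fun j hj j' hj' hne =>
      (h j hj j' hj' hne).trans (by norm_num [tk65]) : s.card ≤ 14)) hx i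

/-- Shell `k = 1`: at most `15` neighbours at distance `< t_2 = 1.30` (degree-`7` angular count). -/
theorem angCount65_1 {N : ℕ} {x : Fin N → EuclideanSpace ℝ (Fin 3)} (hx : Sep (6 / 5) x) (i : Fin N) :
    ((((Finset.univ.erase i).filter fun j => dist (x i) (x j) < tk65 (1 + 1)).card : ℕ) : ℝ) ≤ ((angD65 1 : ℕ) : ℝ) :=
  card_near_le_of_angular' (δ := 6 / 5) (t := tk65 (1 + 1)) (by norm_num) (by norm_num [tk65]) (angD65 1)
    (fun s u hu h => (card_le65_15 s u hu fun j hj j' hj' hne =>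
      (h j hj j' hj' hne).trans (by norm_num [tk65]) : s.card ≤ 15)) hx i

/-- Shell `k = 2`: at most `17` neighbours at distance `< t_3 = 1.35` (degree-`7` angular count). -/
theorem angCount65_2 {N : ℕ} {x : Fin N → EuclideanSpace ℝ (Fin 3)} (hx : Sep (6 / 5) x) (i : Fin N) :
    ((((Finset.univ.erase i).filter fun j => dist (x i) (x j) < tk65 (2 + 1)).card : ℕ) : ℝ) ≤ ((angD65 2 : ℕ) : ℝ) :=
  card_near_le_of_angular' (δ := 6 / 5) (t := tk65 (2 + 1)) (by norm_num) (by norm_num [tk65]) (angD65 2)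
    (fun s u hu h => (card_le65_17 s u hu fun j hj j' hj' hne =>
      (h j hj j' hj' hne).trans (by norm_num [tk65]) : s.card ≤ 17)) hx i

/-- Shell `k = 3`: at most `18` neighbours at distance `< t_4 = 1.40` (degree-`7` angular count). -/
theorem angCount65_3 {N : ℕ} {x : Fin N → EuclideanSpace ℝ (Fin 3)} (hx : Sep (6 / 5) x) (i : Fin N) :
    ((((Finset.univ.erase i).filter fun j => dist (x i) (x j) < tk65 (3 + 1)).card : ℕ) : ℝ) ≤ ((angD65 3 : ℕ) : ℝ) :=
  card_near_le_of_angular' (δ := 6 / 5) (t := tk65 (3 + 1)) (by norm_num) (by norm_num [tk65]) (angD65 3)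
    (fun s u hu h => (card_le65_18 s u hu fun j hj j' hj' hne =>
      (h j hj j' hj' hne).trans (by norm_num [tk65]) : s.card ≤ 18)) hx i

/-- Shell `k = 4`: at most `20` neighbours at distance `< t_5 = 1.45` (degree-`7` angular count). -/
theorem angCount65_4 {N : ℕ} {x : Fin N → EuclideanSpace ℝ (Fin 3)} (hx : Sep (6 / 5) x) (i : Fin N) :
    ((((Finset.univ.erase i).filter fun j => dist (x i) (x j) < tk65 (4 + 1)).card : ℕ) : ℝ) ≤ ((angD65 4 : ℕ) : ℝ) :=
  card_near_le_of_angular' (δ := 6 / 5) (t := tk65 (4 + 1)) (by norm_num) (by norm_num [tk65]) (angD65 4)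
    (fun s u hu h => (card_le65_20 s u hu fun j hj j' hj' hne =>
      (h j hj j' hj' hne).trans (by norm_num [tk65]) : s.card ≤ 20)) hx i

/-- Shell `k = 5`: at most `21` neighbours at distance `< t_6 = 1.50` (degree-`7` angular count). -/
theorem angCount65_5 {N : ℕ} {x : Fin N → EuclideanSpace ℝ (Fin 3)} (hx : Sep (6 / 5) x) (i : Fin N) :
    ((((Finset.univ.erase i).filter fun j => dist (x i) (x j) < tk65 (5 + 1)).card : ℕ) : ℝ) ≤ ((angD65 5 : ℕ) : ℝ) :=
  card_near_le_of_angular' (δ := 6 / 5) (t := tk65 (5 + 1)) (by norm_num) (by norm_num [tk65]) (angD65 5)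
    (fun s u hu h => (card_le65_21 s u hu fun j hj j' hj' hne =>
      (h j hj j' hj' hne).trans (by norm_num [tk65]) : s.card ≤ 21)) hx i

/-- Shell `k = 6`: at most `23` neighbours at distance `< t_7 = 1.55` (degree-`7` angular count). -/
theorem angCount65_6 {N : ℕ} {x : Fin N → EuclideanSpace ℝ (Fin 3)} (hx : Sep (6 / 5) x) (i : Fin N) :
    ((((Finset.univ.erase i).filter fun j => dist (x i) (x j) < tk65 (6 + 1)).card : ℕ) : ℝ) ≤ ((angD65 6 : ℕ) : ℝ) :=
  card_near_le_of_angular' (δ := 6 / 5) (t := tk65 (6 + 1)) (by norm_num) (by norm_num [tk65]) (angD65 6)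
    (fun s u hu h => (card_le65_23 s u hu fun j hj j' hj' hne =>
      (h j hj j' hj' hne).trans (by norm_num [tk65]) : s.card ≤ 23)) hx i

/-- Shell `k = 7`: at most `24` neighbours at distance `< t_8 = 1.60` (degree-`7` angular count). -/
theorem angCount65_7 {N : ℕ} {x : Fin N → EuclideanSpace ℝ (Fin 3)} (hx : Sep (6 / 5) x) (i : Fin N) :
    ((((Finset.univ.erase i).filter fun j => dist (x i) (x j) < tk65 (7 + 1)).card : ℕ) : ℝ) ≤ ((angD65 7 : ℕ) : ℝ) :=
  card_near_le_of_angular' (δ := 6 / 5) (t := tk65 (7 + 1)) (by norm_num) (by norm_num [tk65]) (angD65 7)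
    (fun s u hu h => (card_le65_24 s u hu fun j hj j' hj' hne =>
      (h j hj j' hj' hne).trans (by norm_num [tk65]) : s.card ≤ 24)) hx i

/-- Shell `k = 8`: at most `26` neighbours at distance `< t_9 = 1.65` (degree-`7` angular count). -/
theorem angCount65_8 {N : ℕ} {x : Fin N → EuclideanSpace ℝ (Fin 3)} (hx : Sep (6 / 5) x) (i : Fin N) :
    ((((Finset.univ.erase i).filter fun j => dist (x i) (x j) < tk65 (8 + 1)).card : ℕ) : ℝ) ≤ ((angD65 8 : ℕ) : ℝ) :=
  card_near_le_of_angular' (δ := 6 / 5) (t := tk65 (8 + 1)) (by norm_num) (by norm_num [tk65]) (angD65 8)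
    (fun s u hu h => (card_le65_26 s u hu fun j hj j' hj' hne =>
      (h j hj j' hj' hne).trans (by norm_num [tk65]) : s.card ≤ 26)) hx i

/-- Shell `k = 9`: at most `28` neighbours at distance `< t_10 = 1.70` (degree-`7` angular count). -/
theorem angCount65_9 {N : ℕ} {x : Fin N → EuclideanSpace ℝ (Fin 3)} (hx : Sep (6 / 5) x) (i : Fin N) :
    ((((Finset.univ.erase i).filter fun j => dist (x i) (x j) < tk65 (9 + 1)).card : ℕ) : ℝ) ≤ ((angD65 9 : ℕ) : ℝ) :=
  card_near_le_of_angular' (δ := 6 / 5) (t := tk65 (9 + 1)) (by norm_num) (by norm_num [tk65]) (angD65 9)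
    (fun s u hu h => (card_le65_28 s u hu fun j hj j' hj' hne =>
      (h j hj j' hj' hne).trans (by norm_num [tk65]) : s.card ≤ 28)) hx i

/-- Shell `k = 10`: at most `31` neighbours at distance `< t_11 = 1.75` (degree-`7` angular count). -/
theorem angCount65_10 {N : ℕ} {x : Fin N → EuclideanSpace ℝ (Fin 3)} (hx : Sep (6 / 5) x) (i : Fin N) :
    ((((Finset.univ.erase i).filter fun j => dist (x i) (x j) < tk65 (10 + 1)).card : ℕ) : ℝ) ≤ ((angD65 10 : ℕ) : ℝ)
        :=
  card_near_le_of_angular' (δ := 6 / 5) (t := tk65 (10 + 1)) (by norm_num) (by norm_num [tk65]) (angD65 10)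
    (fun s u hu h => (card_le65_31 s u hu fun j hj j' hj' hne =>
      (h j hj j' hj' hne).trans (by norm_num [tk65]) : s.card ≤ 31)) hx i

/-- Shell `k = 11`: at most `34` neighbours at distance `< t_12 = 1.80` (degree-`7` angular count). -/
theorem angCount65_11 {N : ℕ} {x : Fin N → EuclideanSpace ℝ (Fin 3)} (hx : Sep (6 / 5) x) (i : Fin N) :
    ((((Finset.univ.erase i).filter fun j => dist (x i) (x j) < tk65 (11 + 1)).card : ℕ) : ℝ) ≤ ((angD65 11 : ℕ) : ℝ)
        :=
  card_near_le_of_angular' (δ := 6 / 5) (t := tk65 (11 + 1)) (by norm_num) (by norm_num [tk65]) (angD65 11)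
    (fun s u hu h => (card_le65_34 s u hu fun j hj j' hj' hne =>
      (h j hj j' hj' hne).trans (by norm_num [tk65]) : s.card ≤ 34)) hx i

/-- Shell `k = 12`: at most `38` neighbours at distance `< t_13 = 1.85` (degree-`7` angular count). -/
theorem angCount65_12 {N : ℕ} {x : Fin N → EuclideanSpace ℝ (Fin 3)} (hx : Sep (6 / 5) x) (i : Fin N) :
    ((((Finset.univ.erase i).filter fun j => dist (x i) (x j) < tk65 (12 + 1)).card : ℕ) : ℝ) ≤ ((angD65 12 : ℕ) : ℝ)
        :=
  card_near_le_of_angular' (δ := 6 / 5) (t := tk65 (12 + 1)) (by norm_num) (by norm_num [tk65]) (angD65 12)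
    (fun s u hu h => (card_le65_38 s u hu fun j hj j' hj' hne =>
      (h j hj j' hj' hne).trans (by norm_num [tk65]) : s.card ≤ 38)) hx i

/-- Shell `k = 13`: at most `43` neighbours at distance `< t_14 = 1.90` (degree-`7` angular count). -/
theorem angCount65_13 {N : ℕ} {x : Fin N → EuclideanSpace ℝ (Fin 3)} (hx : Sep (6 / 5) x) (i : Fin N) :
    ((((Finset.univ.erase i).filter fun j => dist (x i) (x j) < tk65 (13 + 1)).card : ℕ) : ℝ) ≤ ((angD65 13 : ℕ) : ℝ)
        :=
  card_near_le_of_angular' (δ := 6 / 5) (t := tk65 (13 + 1)) (by norm_num) (by norm_num [tk65]) (angD65 13)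
    (fun s u hu h => (card_le65_43 s u hu fun j hj j' hj' hne =>
      (h j hj j' hj' hne).trans (by norm_num [tk65]) : s.card ≤ 43)) hx i

/-- Every shell count is under the envelope `m_k`. -/
theorem count_le_mk65 {N : ℕ} {x : Fin N → EuclideanSpace ℝ (Fin 3)} (hx : Sep (6 / 5) x) (i : Fin N) (k : ℕ)
    (hk : k < 72) :
    ((((Finset.univ.erase i).filter fun j => dist (x i) (x j) < tk65 (k + 1)).card : ℕ) : ℝ) ≤ mk65 k := by
  by_cases h14 : k < 14
  · rw [mk65, if_pos h14]
    interval_cases k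
    · exact angCount65_0 hx i
    · exact angCount65_1 hx i
    · exact angCount65_2 hx i
    · exact angCount65_3 hx i
    · exact angCount65_4 hx i
    · exact angCount65_5 hx i
    · exact angCount65_6 hx i
    · exact angCount65_7 hx i
    · exact angCount65_8 hx i
    · exact angCount65_9 hx i
    · exact angCount65_10 hx i
    · exact angCount65_11 hx i
    · exact angCount65_12 hx i
    · exact angCount65_13 hx i
  · rw [mk65, if_neg h14]
    exact card_near_le (by norm_num) hx i (le_trans (by norm_num) (six_fifths_le_tk65 (k + 1)))

/-! ## The certified floor of the pair-sum at hard core `6/5` -/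

/-- **Certified floor**: at every site of every `6/5`-separated finite configuration the pair-sum is `≥ −1.435`. -/
theorem sum_lennardJones_ge_of_sep65 {N : ℕ} {x : Fin N → EuclideanSpace ℝ (Fin 3)} (hx : Sep (6 / 5) x)
    (i : Fin N) : -(1435 / 1000 : ℝ) ≤ ∑ j ∈ Finset.univ.erase i, lennardJones (dist (x i) (x j)) := by
  set S := Finset.univ.erase i with hS
  have hδ : (0 : ℝ) < 6 / 5 := by norm_num
  have hdist : ∀ j ∈ S, 6 / 5 ≤ dist (x i) (x j) := fun j hj =>
    hx i j (Finset.ne_of_mem_erase hj).symm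
  -- pointwise majorant, summed
  have step1 : ∑ j ∈ S, (layer65 (dist (x i) (x j)) + tailTerm65 (dist (x i) (x j))) ≤
      ∑ j ∈ S, lennardJones (dist (x i) (x j)) :=
    Finset.sum_le_sum fun j hj => layer65_add_tail_le (hdist j hj)
  -- the layer part: swap sums, bound counts by the envelope (weights are nonpositive)
  have step2 : ∑ k ∈ Finset.range 72, wk65 k * mk65 k ≤ ∑ j ∈ S, layer65 (dist (x i) (x j)) := by
    have hswap : ∑ j ∈ S, layer65 (dist (x i) (x j)) =
        ∑ k ∈ Finset.range 72, wk65 k * ∑ j ∈ S, (if dist (x i) (x j) < tk65 (k + 1) then (1 : ℝ) else 0) := by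
      simp only [layer65, Finset.mul_sum]
      exact Finset.sum_comm
    rw [hswap]
    refine Finset.sum_le_sum fun k hk => ?_
    have hcount : ∑ j ∈ S, (if dist (x i) (x j) < tk65 (k + 1) then (1 : ℝ) else 0) ≤ mk65 k := by
      rw [Finset.sum_boole]
      exact count_le_mk65 hx i k (Finset.mem_range.1 hk)
    exact mul_le_mul_of_nonpos_left hcount (wk65_nonpos (Finset.mem_range.1 hk))
  -- the tail part
  have step3 : -((1 / 6) * (1331 / 512 * (6 / 5 : ℝ)⁻¹ ^ 6)) ≤ ∑ j ∈ S, tailTerm65 (dist (x i) (x j)) := by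
    have hsplit : ∑ j ∈ S, tailTerm65 (dist (x i) (x j)) =
        ∑ j ∈ S.filter (fun j => tk65 72 ≤ dist (x i) (x j)), -((1 / 6) * (dist (x i) (x j))⁻¹ ^ 6) := by
      rw [Finset.sum_filter]
      rfl
    have htail := sum_inv_pow_six_far_le x hδ hx i
    rw [← tk65_last] at htail
    rw [hsplit, Finset.sum_neg_distrib, ← Finset.mul_sum, neg_le_neg_iff]
    exact mul_le_mul_of_nonneg_left htail (by norm_num)
  have := grid65_sum_ge
  rw [Finset.sum_add_distrib] at step1
  linarith

/-- **The half pair-sum never drops below `−0.7175` at hard core `6/5`.** -/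
theorem halfSum_ge_of_sep65 {N : ℕ} {x : Fin N → EuclideanSpace ℝ (Fin 3)} (hx : Sep (6 / 5) x) (i : Fin N) :
    -(7175 / 10000 : ℝ) ≤ (∑ j ∈ Finset.univ.erase i, lennardJones (dist (x i) (x j))) / 2 := by
  have := sum_lennardJones_ge_of_sep65 hx i
  linarith

/-! ## The rungs and the threshold bracket -/

/-- **The deepest-site inequality holds at hard core `6/5`.** -/
theorem halfSumFeasible_six_fifths : HalfSumFeasible (6 / 5) := fun _ _ hx i =>
  eInf_le_ref.trans (halfSum_ge_of_sep65 hx i)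

/-- … and at every larger hard core. -/
theorem halfSumFeasible_of_six_fifths_le {δ : ℝ} (h : 6 / 5 ≤ δ) : HalfSumFeasible δ :=
  halfSumFeasible_mono h halfSumFeasible_six_fifths

/-- **The half rule is feasible at hard core `6/5`, at every radius.** -/
theorem feasible_halfRule_six_fifths (R : ℝ) : Feasible (6 / 5) R halfRule :=
  (feasible_halfRule_iff (6 / 5) R).2 halfSumFeasible_six_fifths

/-- **`RungAt (6/5) R` for every `R`.** -/
theorem rungAt_six_fifths (R : ℝ) : RungAt (6 / 5) R :=
  rungAt_of_halfSumFeasible halfSumFeasible_six_fifths R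

/-- **The hard-core end of the `δ`-ladder, lowered again**: every `δ ≥ 6/5` has every rung. -/
theorem rungAt_of_six_fifths_le {δ : ℝ} (hδ : 6 / 5 ≤ δ) (R : ℝ) : RungAt δ R :=
  rungAt_of_halfSumFeasible (halfSumFeasible_of_six_fifths_le hδ) R

/-- Read back on crux r2: its `δ`-instances for `δ ≥ 6/5` are theorems (witness: any `R > 0`, the half rule). -/
theorem exists_rung_of_six_fifths_le : ∀ δ : ℝ, 6 / 5 ≤ δ → ∃ R : ℝ, 0 < R ∧ RungAt δ R :=
  fun _ hδ => ⟨1, one_pos, rungAt_of_six_fifths_le hδ 1⟩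

/-- `δ_½ ≤ 6/5` for the sharp threshold `halfSumThreshold` of `…RadiusLadderThreshold`. -/
theorem halfSumThreshold_le_six_fifths : halfSumThreshold ≤ 6 / 5 :=
  halfSumThreshold_le_of halfSumFeasible_six_fifths

/-- **The bracket**: `47/50 ≤ δ_½ ≤ 6/5` (`Star902`; the degree-`7` Delsarte layer cake). -/
theorem halfSumThreshold_mem_Icc_47_50_6_5 : halfSumThreshold ∈ Set.Icc ((47 : ℝ) / 50) (6 / 5) :=
  ⟨le_halfSumThreshold_47_50, halfSumThreshold_le_six_fifths⟩

/-- **The small-radius rungs, decided outside `(47/50, 6/5)`**: for `0 < R < δ`, `RungAt δ R` holds if `δ ≥ 6/5`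
and fails if `δ ≤ 47/50`; in between it is the single open inequality `HalfSumFeasible δ`. -/
theorem rungAt_lt_sep_decided65 {δ R : ℝ} (hδ : 0 < δ) (hR : R < δ) :
    (6 / 5 ≤ δ → RungAt δ R) ∧ (δ ≤ 47 / 50 → ¬ RungAt δ R) ∧ (RungAt δ R ↔ HalfSumFeasible δ) :=
  ⟨fun h => rungAt_of_six_fifths_le h R,
    fun h hr => not_halfSumFeasible_of_le_47_50 h (halfSumFeasible_of_rungAt hδ hR hr),
    rungAt_iff_halfSumFeasible_of_lt hδ hR⟩

end Summit.AtomisticToContinuum.Crystallization.Theorems.StrictSplittingRuleBirth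

end
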